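import Literature.AlgebraicGeometry.Resolution.KummerOneUnitsVT
import HarnessLib

/-!
# Kummer radicands `1 + b` over `K(x)^h`: the first elimination step and GOOD radicands (Kuhlmann 2010, Prop. 4.6, proof)

Topic: `Literature/AlgebraicGeometry/Resolution` (valued function fields). Continuation of
`KummerOneUnitsVT.lean`: the proof of F.-V. Kuhlmann, *Elimination of ramification I: The
generalized stability theorem*, Trans. AMS 362 (2010) 5697–5727 = arXiv:1003.5678, §4.1,
**Prop. 4.6**, for a Kummer generator `ϑ` of a Galois extension of degree `p` of `F = K(x)^h`
(`K` algebraically closed of characteristic `0`, `x` value-transcendental, `F` of rank one,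
`char K̄ = p`) with radicand a `1`-unit `ϑ^p = 1 + b`:

> In a first step, we will eliminate all `p`-th powers `≠ c₀` of value `≤ vp` in the above sum.
> … write them as `z₁^{p^ν}, …, z_n^{p^ν}`. … Using (11), we replace `u` by
> `u' := u/(1+∑_{j=1}^{n} z_j)^{p^ν} = …` Using the geometrical series expansion as in the proof
> of Lemma 4.4, we find that the first quotient on the right hand side is equivalent to `1`
> modulo `p𝓜_F`. …

## Content (everything PROVED)

Setting and GOOD radicands as in `KummerOneUnitsVT.lean` (`v(b) = v(c x^j)`, `c ∈ K^×`,
`p ∤ j`).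

* `exists_good_or_valuation_lt_radicand` — **the first elimination step**: for `ϑ^p = 1 + b`,
  `b ∈ F`, `v(b) < 1`, approximate `b` by a finite Laurent series `∑ cᵢxⁱ` to order
  `(p/(p-1))vp` (Lemma 4.4, `exists_mem_span_valuation_sub_lt`) and divide by
  `(1 + ∑_{p∣i} cᵢ^{1/p}x^{i/p})^p = 1 + ∑_{p∣i} cᵢxⁱ + e`, `ve > vp`
  (`exists_one_add_sum_pow_prime_eq`): the new radicand is `∑_{p∤i} cᵢxⁱ + (error of level > vp)`
  up to a unit, hence either GOOD (the monomials with `i ∉ pℤ` dominate) or of level `> vp`.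
* `exists_good_radicand` — **for `ϑ ∉ F` with `ϑ^p = 1 + b`, `b ∈ F`, `v(b) < 1`, some
  `F^×`-multiple `ϑw` has `(ϑw)^p = 1 + b'` with `b'` GOOD** (first step, then
  `exists_laurent_radicand` and the cascade `exists_good_radicand_of_laurent`).
* `exists_valuation_not_mem_of_oneUnit_radicand` — consequently `v(ϑw - 1) ∉ vF` while
  `v(ϑw - 1)^p ∈ vF` ("`vη = (1/p)vc_j - vC + (j/p)vx ∉ vK ⊕ ℤvx = vF`").

## Sources

* F.-V. Kuhlmann, *Elimination of ramification I: The generalized stability theorem*, Trans.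
  Amer. Math. Soc. 362 (2010) 5697–5727 = arXiv:1003.5678: §2.2 (Lemma 2.10, Cor. 2.11),
  §4.1 (Lemma 4.4, Prop. 4.6 and its proof, pp. 12–13). [Kuhlmann2010]

## Rendering notes

* As explained in `KummerOneUnitsVT.lean`, the printed descending induction over `p^ν`-th
  powers is replaced by one division by `(1 + ∑_{p∣i} cᵢ^{1/p}x^{i/p})^p` sorted by value; the
  end result used by Prop. 4.6 — a radicand whose value is `vc_jx^j` with `j ∉ pℤ` — is the
  printed one.
-/

noncomputable section

open IsLocalRing

namespace Literature.AlgebraicGeometry.Resolution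

universe u

variable {Ω : Type u} [Field Ω] (V : ValuationSubring Ω)

section Kummer

variable [IsAlgClosed Ω] {p : ℕ} [hp : Fact p.Prime] {K : Subfield Ω} (hK : IsAlgClosed K)
  {x : Ω} (hx : IsValueTranscendentalOver V K x) (hr : IsRankOneValued V (henselizedAdjoin V K x))
  {C : Ω} (hCK : C ∈ K) (hC : C ^ (p - 1) = -(p : Ω)) (hp0 : (p : Ω) ≠ 0)
  (hvp : V.valuation (p : Ω) < 1)
include hK hx hr hCK hC hp0 hvp

/-- **The first elimination step** (Kuhlmann 2010, proof of Prop. 4.6: "In a first step, we will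
eliminate all `p`-th powers … we replace `u` by `u' := u/(1+∑ z_j)^{p^ν}` … equivalent to `1`
modulo `p𝓜_F`"): for `ϑ^p = 1 + b`, `b ∈ F = K(x)^h`, `v(b) < 1`, there are `w ∈ F^×` and
`b' ∈ F`, `v(b') < 1`, with `(ϑw)^p = 1 + b'` and either `b'` GOOD (`v(b') = v(c x^j)`, `c ∈ K^×`,
`p ∤ j`) or `v(b') < v(p)`. PROVED: `b ≈ ∑ cᵢxⁱ` to order `v(C^p)` (Lemma 4.4), `w⁻¹ = 1 + ∑_{p∣i}
cᵢ^{1/p}x^{i/p}`, whose `p`-th power is `1 + ∑_{p∣i} cᵢxⁱ` up to an error of level `> vp`.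
[cite: Kuhlmann2010, Section 4.1, proof of Prop. 4.6] -/
theorem exists_good_or_valuation_lt_radicand {ϑ b : Ω} (hbF : b ∈ henselizedAdjoin V K x)
    (hb1 : V.valuation b < 1) (hϑ : ϑ ^ p = 1 + b) :
    ∃ w ∈ henselizedAdjoin V K x, w ≠ 0 ∧ ∃ b' ∈ henselizedAdjoin V K x,
      (ϑ * w) ^ p = 1 + b' ∧ V.valuation b' < 1 ∧
      ((∃ c ∈ K, c ≠ 0 ∧ ∃ j : ℤ, ¬ (p : ℤ) ∣ j ∧ V.valuation b' = V.valuation (c * x ^ j)) ∨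
        V.valuation b' < V.valuation (p : Ω)) := by
  classical
  haveI := hK
  set F := henselizedAdjoin V K x with hFdef
  have hKF : K ≤ F := le_henselizedAdjoin V K x
  have hxF : x ∈ F := mem_henselizedAdjoin_self V K x
  have hCF : C ∈ F := hKF hCK
  have hC0 : C ≠ 0 := C_ne_zero hp.out hC hp0
  have hvCp : V.valuation C ^ p < V.valuation (p : Ω) :=
    valuation_C_pow_lt_valuation_p V hp.out hC hp0 hvp
  have hvCp1 : V.valuation C ^ p < 1 := valuation_C_pow_lt_one V hp.out hC hvp
  have hvp0 : 0 < V.valuation (p : Ω) := (Valuation.pos_iff _).mpr hp0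
  ---------------------------------------------------------------- Lemma 4.4: `b ≈ r = ∑ cᵢxⁱ`
  obtain ⟨r, hrR, hbr⟩ := exists_mem_span_valuation_sub_lt hx hr hbF (pow_mem hCF p)
    (pow_ne_zero p hC0)
  obtain ⟨c₀, rfl⟩ := exists_finsupp_of_mem_span K x hrR
  set r : Ω := c₀.sum fun i a => (a : Ω) * x ^ i with hrdef
  have hrF : r ∈ F := finsuppSum_mem hKF hxF c₀
  have hbr' : V.valuation (b - r) < V.valuation C ^ p := by rwa [map_pow] at hbr
  have hvr1 : V.valuation r < 1 := by
    have : r = b - (b - r) := by ring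
    rw [this]
    exact Valuation.map_sub_lt _ hb1 (hbr'.trans hvCp1)
  have hmono : ∀ k ∈ c₀.support, V.valuation ((c₀ k : Ω) * x ^ k) < 1 := fun k hk =>
    (valuation_monomial_le_finsuppSum V hx hk).trans_lt hvr1
  ---------------------------------------------------------------- `p`-th roots of the coefficients
  have hroots := fun k : ℤ => IsAlgClosed.exists_pow_nat_eq (c₀ k) hp.out.pos
  choose ρ hρ using hroots
  have hρ' : ∀ k, ((ρ k : K) : Ω) ^ p = ((c₀ k : K) : Ω) := fun k => by
    have := congrArg (fun z : K => (z : Ω)) (hρ k)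
    simpa using this
  set D : Finset ℤ := c₀.support.filter (fun k => (p : ℤ) ∣ k) with hD
  set z : ℤ → Ω := fun k => (ρ k : Ω) * x ^ (k / p) with hz
  have hzp : ∀ k ∈ D, z k ^ p = ((c₀ k : K) : Ω) * x ^ k := by
    intro k hk
    obtain ⟨-, hpk⟩ := Finset.mem_filter.mp hk
    show ((ρ k : Ω) * x ^ (k / p)) ^ p = _
    rw [mul_pow, hρ' k, ← zpow_natCast (x ^ (k / p)), ← zpow_mul, Int.ediv_mul_cancel hpk]
  have hzF : ∀ k ∈ D, z k ∈ F := fun k _ => mul_mem (hKF (ρ k).2) (zpow_mem hxF _)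
  have hz1 : ∀ k ∈ D, V.valuation (z k) < 1 := by
    intro k hk
    obtain ⟨hkc, -⟩ := Finset.mem_filter.mp hk
    refine lt_of_pow_lt_pow_left₀ p zero_le ?_
    rw [one_pow, ← map_pow, hzp k hk]
    exact hmono k hkc
  obtain ⟨e, heF, he, hexp⟩ := exists_one_add_sum_pow_prime_eq V hp.out hp0 D z hzF hz1
  ---------------------------------------------------------------- split `r = B_p + B'`
  set cP : ℤ →₀ K := c₀.filter (fun k => (p : ℤ) ∣ k) with hcP
  set cN : ℤ →₀ K := c₀.filter (fun k => ¬ (p : ℤ) ∣ k) with hcN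
  set B' : Ω := cN.sum fun i a => (a : Ω) * x ^ i with hB'
  have hB'F : B' ∈ F := finsuppSum_mem hKF hxF cN
  have hsplit : r = (cP.sum fun i a => (a : Ω) * x ^ i) + B' := by
    rw [hrdef, hB', hcP, hcN, ← finsuppSum_add, Finsupp.filter_add_filter_not]
  have hBp : (cP.sum fun i a => (a : Ω) * x ^ i) = ∑ k ∈ D, z k ^ p := by
    rw [Finsupp.sum, hcP, Finsupp.support_filter]
    refine Finset.sum_congr rfl fun k hk => ?_
    obtain ⟨-, hpk⟩ := Finset.mem_filter.mp hk
    rw [Finsupp.filter_apply_pos _ _ hpk, hzp k hk]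
  have hcNmono : ∀ k ∈ cN.support, V.valuation ((cN k : Ω) * x ^ k) < 1 := by
    intro k hk
    rw [hcN, Finsupp.support_filter] at hk
    obtain ⟨hkc, hpk⟩ := Finset.mem_filter.mp hk
    rw [hcN, Finsupp.filter_apply_pos (fun k => ¬ (p : ℤ) ∣ k) c₀ hpk]
    exact hmono k hkc
  have hvB' : V.valuation B' < 1 := valuation_finsuppSum_lt V one_ne_zero hcNmono
  ---------------------------------------------------------------- the unit `w₁ = 1 + ∑ z_k`
  set w₁ : Ω := 1 + ∑ k ∈ D, z k with hw₁
  have hw₁F : w₁ ∈ F := add_mem F.one_mem (sum_mem fun k hk => hzF k hk)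
  have hsum1 : V.valuation (∑ k ∈ D, z k) < V.valuation (1 : Ω) := by
    rw [map_one]
    exact Valuation.map_sum_lt _ one_ne_zero hz1
  have hvw₁ : V.valuation w₁ = 1 := by
    rw [hw₁, Valuation.map_add_eq_of_lt_left _ hsum1, map_one]
  have hw₁0 : w₁ ≠ 0 := fun h => by rw [h, map_zero] at hvw₁; exact zero_ne_one hvw₁
  -- `1 + b = w₁^p + X` with `X = B' + ((b - r) - e)`
  set Y : Ω := b - r - e with hY
  set X : Ω := B' + Y with hX
  have hXF : X ∈ F := add_mem hB'F (sub_mem (sub_mem hbF hrF) heF)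
  have hkey : 1 + b = w₁ ^ p + X := by
    rw [hw₁, hexp, ← hBp, hX, hY]
    linear_combination hsplit
  have hvY : V.valuation Y < V.valuation (p : Ω) := Valuation.map_sub_lt _ (hbr'.trans hvCp) he
  set b' : Ω := X / w₁ ^ p with hb'
  have hb'F : b' ∈ F := div_mem hXF (pow_mem hw₁F p)
  have hvb' : V.valuation b' = V.valuation X := by
    rw [hb', map_div₀, map_pow, hvw₁, one_pow, div_one]
  have hϑ' : (ϑ * w₁⁻¹) ^ p = 1 + b' := by
    rw [mul_pow, inv_pow, hϑ, hkey, hb', add_mul, mul_inv_cancel₀ (pow_ne_zero p hw₁0),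
      div_eq_mul_inv]
  refine ⟨w₁⁻¹, F.inv_mem hw₁F, inv_ne_zero hw₁0, b', hb'F, hϑ', ?_, ?_⟩
  · rw [hvb', hX]
    exact Valuation.map_add_lt _ hvB' (hvY.trans hvp)
  ---------------------------------------------------------------- the dichotomy
  by_cases hgood : cN ≠ 0 ∧ V.valuation Y < V.valuation B'
  · left
    obtain ⟨hcN0, hYB⟩ := hgood
    obtain ⟨j, hj, hjval, -⟩ := exists_valuation_finsupp_sum_eq hx hcN0
    have hj' : j ∈ c₀.support ∧ ¬ (p : ℤ) ∣ j := by
      rw [hcN, Finsupp.support_filter] at hj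
      exact Finset.mem_filter.mp hj
    refine ⟨(cN j : Ω), (cN j).2, coe_finsupp_ne_zero hj, j, hj'.2, ?_⟩
    rw [hvb', hX, Valuation.map_add_eq_of_lt_left _ hYB]
    exact hjval
  · right
    rw [hvb', hX]
    by_cases h0 : cN = 0
    · have : B' = 0 := by rw [hB', h0, Finsupp.sum_zero_index]
      rw [this, zero_add]
      exact hvY
    · have hle : V.valuation B' ≤ V.valuation Y := not_lt.mp fun hlt => hgood ⟨h0, hlt⟩
      calc V.valuation (B' + Y) ≤ max (V.valuation B') (V.valuation Y) := Valuation.map_add _ _ _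
        _ = V.valuation Y := max_eq_right hle
        _ < V.valuation (p : Ω) := hvY

/-- **GOOD radicands for Kummer generators with `1`-unit radicand** (Kuhlmann 2010, proof of
Prop. 4.6, from "By Lemma 4.4 and part a) of Corollary 2.11 …" to "We have that `j ∉ pℤ`"): for
`ϑ ∉ F = K(x)^h` with `ϑ^p = 1 + b`, `b ∈ F`, `v(b) < 1`, there are `w ∈ F^×` and `b' ∈ F` with
`(ϑw)^p = 1 + b'`, `v(b') < 1`, and `v(b') = v(c x^j)` for some `c ∈ K^×`, `p ∤ j`. PROVED
(`exists_good_or_valuation_lt_radicand`, `exists_laurent_radicand`,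
`exists_good_radicand_of_laurent`). [cite: Kuhlmann2010, Section 4.1, proof of Prop. 4.6] -/
theorem exists_good_radicand {ϑ b : Ω} (hϑF : ϑ ∉ henselizedAdjoin V K x)
    (hbF : b ∈ henselizedAdjoin V K x) (hb1 : V.valuation b < 1) (hϑ : ϑ ^ p = 1 + b) :
    ∃ w ∈ henselizedAdjoin V K x, w ≠ 0 ∧ ∃ b' ∈ henselizedAdjoin V K x,
      (ϑ * w) ^ p = 1 + b' ∧ V.valuation b' < 1 ∧
      ∃ c ∈ K, c ≠ 0 ∧ ∃ j : ℤ, ¬ (p : ℤ) ∣ j ∧ V.valuation b' = V.valuation (c * x ^ j) := by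
  obtain ⟨w₁, hw₁F, hw₁0, b₁, hb₁F, hϑ₁, hb₁1, hcase⟩ :=
    exists_good_or_valuation_lt_radicand V hK hx hr hCK hC hp0 hvp hbF hb1 hϑ
  rcases hcase with hgood | hlow
  · exact ⟨w₁, hw₁F, hw₁0, b₁, hb₁F, hϑ₁, hb₁1, hgood⟩
  · obtain ⟨w₂, hw₂F, hw₂0, ℓ, hϑ₂, h0, hval⟩ :=
      exists_laurent_radicand V hK hx hr hCK hC hp0 hvp hb₁F hlow hϑ₁
    have hϑF₂ : ϑ * w₁ * w₂ ∉ henselizedAdjoin V K x :=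
      mul_not_mem_of_not_mem (mul_not_mem_of_not_mem hϑF hw₁F hw₁0) hw₂F hw₂0
    obtain ⟨w₃, hw₃F, hw₃0, b', hb'F, hϑ₃, hb'v, hgood⟩ :=
      exists_good_radicand_of_laurent V hK hx hCK hC hp0 hvp _ ℓ (ϑ * w₁ * w₂) rfl h0 hval
        hϑF₂ hϑ₂
    refine ⟨w₁ * w₂ * w₃, mul_mem (mul_mem hw₁F hw₂F) hw₃F,
      mul_ne_zero (mul_ne_zero hw₁0 hw₂0) hw₃0, b', hb'F, ?_, hb'v.trans hvp, hgood⟩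
    rw [show ϑ * (w₁ * w₂ * w₃) = ϑ * w₁ * w₂ * w₃ by ring]
    exact hϑ₃

/-- **The value of `ϑw - 1` lies outside `vF`, its `p`-th power inside** (Kuhlmann 2010, proof
of Prop. 4.6, conclusion: "`pvϑ = v(b/C^p)` … This yields `vη = (1/p)vc_j - vC + (j/p)vx ∉
vK ⊕ ℤvx = vF`"): for `ϑ ∉ F = K(x)^h` with `ϑ^p = 1 + b`, `b ∈ F`, `v(b) < 1`, there are
`t ∈ F·ϑ + F` — namely `t = ϑw - 1` — hence `t` in every field containing `F` and `ϑ`, with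
`t ≠ 0`, `v(t) ≠ v(f)` for all `f ∈ F^×`, and `v(t)^p = v(g)` for some `g ∈ F^×`. PROVED
(`exists_good_radicand`, `valuation_C_pow_lt_of_good`, `valuation_sub_one_pow_eq`,
`not_valuation_pow_eq_of_not_dvd`). [cite: Kuhlmann2010, Section 4.1, proof of Prop. 4.6] -/
theorem exists_valuation_not_mem_of_oneUnit_radicand {ϑ b : Ω} (hϑF : ϑ ∉ henselizedAdjoin V K x)
    (hbF : b ∈ henselizedAdjoin V K x) (hb1 : V.valuation b < 1) (hϑ : ϑ ^ p = 1 + b) :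
    ∃ w ∈ henselizedAdjoin V K x, ϑ * w - 1 ≠ 0 ∧
      (∀ f ∈ henselizedAdjoin V K x, f ≠ 0 → V.valuation (ϑ * w - 1) ≠ V.valuation f) ∧
      ∃ g ∈ henselizedAdjoin V K x, g ≠ 0 ∧ V.valuation (ϑ * w - 1) ^ p = V.valuation g := by
  have hKF : K ≤ henselizedAdjoin V K x := le_henselizedAdjoin V K x
  have hxF : x ∈ henselizedAdjoin V K x := mem_henselizedAdjoin_self V K x
  obtain ⟨w, hwF, hw0, b', hb'F, hϑw, hb'1, c, hc, hc0, j, hpj, hval⟩ :=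
    exists_good_radicand V hK hx hr hCK hC hp0 hvp hϑF hbF hb1 hϑ
  -- `1 + b'` is not a `p`-th power in `F`
  have hϑwF : ϑ * w ∉ henselizedAdjoin V K x := mul_not_mem_of_not_mem hϑF hwF hw0
  have hnot : ∀ w' ∈ henselizedAdjoin V K x, w' ^ p ≠ 1 + b' := by
    intro w' hw'F h
    rw [← hϑw] at h
    exact pow_ne_pow_of_not_mem hK hKF hp.out.ne_zero hϑwF hw'F h
  have hCb : V.valuation C ^ p < V.valuation b' :=
    valuation_C_pow_lt_of_good V hx hCK hC hp0 hvp hb'F hnot hc hc0 hpj hval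
  -- `v(ϑw - 1)^p = v(b') = v(c x^j)`
  have hpow : V.valuation (ϑ * w - 1) ^ p = V.valuation (c * x ^ j) := by
    rw [valuation_sub_one_pow_eq V hp.out hC hp0 hϑw hb'1 hCb, hval]
  have hm0 : c * x ^ j ≠ 0 := mul_ne_zero hc0 (zpow_ne_zero _ hx.ne_zero)
  refine ⟨w, hwF, ?_, ?_, c * x ^ j, mul_mem (hKF hc) (zpow_mem hxF j), hm0, hpow⟩
  · intro h0
    rw [h0, map_zero, zero_pow hp.out.ne_zero, eq_comm, map_eq_zero] at hpow
    exact hm0 hpow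
  · intro f hf hf0 hvf
    rw [hvf] at hpow
    exact not_valuation_pow_eq_of_not_dvd V hx hp.out.ne_zero hpj hc hc0 hf hpow

end Kummer

end Literature.AlgebraicGeometry.Resolution
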